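import Literature.AlgebraicGeometry.Frobenioids.ArithmeticRealificationBiratCompat
import Literature.AlgebraicGeometry.Frobenioids.Cor411iiiOfFSMType
import Literature.AlgebraicGeometry.Frobenioids.Cor411iiAssemblyFSM
import HarnessLib

/-!
# Frobenioids I, Cor. 4.11 (ii)/(iii)/(iv) AT THE REALIFICATIONS `C_{K/F}^rlf` of the arithmetic Frobenioids, for an
# ARBITRARY equivalence `Ψ^rlf : C_{K₁/F₁}^rlf ⥲ C_{K₂/F₂}^rlf` (Thm. 6.4 (ii), input E5 — part B, hypothesis-free)

Mochizuki, *The geometry of Frobenioids I: the general theory*, Kyushu J. Math. **62** (2008) 293–400, kurims text: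
Cor. 4.11 (ii)/(iii)/(iv) p. 91 l. 28 – p. 92 l. 32; Thm. 4.9 p. 88; Thm. 6.4 (ii) p. 114 ("Let `Ψ^rlf : C₁^rlf ⥲ C₂^rlf` be
an equivalence of categories …", proof p. 115 l. 34 – p. 116 l. 2: "the isomorphism `Pic_Φ(A₁) ⥲ Pic_Φ(A₂)` … arises
from an isomorphism of monoids `Φ₁^rlf(A₁) ⥲ Φ₂^rlf(A₂)` [cf. Corollary 4.11, (iii)]")
[cite: MochizukiFrdI2008, Cor. 4.11 (iii) p.92] [cite: MochizukiFrdI2008, Thm. 6.4 (ii) p.114].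

PROOF-ONLY file (cell abc-iut, layer L1, node `FrdI:Thm6.4(ii)`, sub-DAG row **T64ii/E5** part B; seat abc-iut-L6-t10
gen 4).  `C_{K/F}^rlf` (`PreFrobenioid.rlf`, Prop. 5.3, seat abc-iut-L1-d2) IS a Frobenioid of isotropic, rationally
standard, non-group-like type over the FSM-type base `D = B(Gal(K/F))⁰` (Thm. 6.4 (i): `arith_rlf_isFrobenioid`,
`arith_rlf_isOfRationallyStandardType`, `arith_rlf_not_isOfGroupLikeType`, `FinSubextCat.isOfFSMType`), so the cell's
GENERAL closers of Cor. 4.11 over FSM-type bases (seat abc-iut-L1-d6 `PreFrobenioid.cor411ii_ofFunctor_of_isOfFSMType`;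
seat abc-iut-L1-t14 `FrdI.cor411iii_of_cor411ii_of_isOfFSMType`, `FrdI.cor411iv_of_cor411ii_of_isOfFSMType`,
`FrdI.T49.exists_divisorMonoidIsoOver_div_of_isOfFSMType`) apply to the Frobenioids `C_{K_i/F_i}^rlf → F_{Φ_i^rlf}` and to
ANY equivalence `Ψ^rlf` between them (hypotheses: part A's `arith_rlf_cor411Setting`):
* `arith_rlf_cor411iii` / `arith_rlf_cor411iv` — the typed `Cor411iii` / `Cor411iv` at THE realified operations and THE
  Def. 4.5 (iii) parameters; `arith_rlf_cor411iii_conclusion` — (iii)'s conclusion with every antecedent discharged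
  (seat abc-iut-w5-d250's `arith_rlf_isOfRationallyStandardType`): a `1`-unique `Ψ^Base : D₁ ⥲ D₂` and an
  isomorphism of monoids `Φ₁^rlf ⥲ Φ₂^rlf` over it;
* `arith_rlf_exists_divTransportData` — THE data `(Ψ^Base, η, Ψ^Φ = E)` with `Div(Ψ^rlf φ) = η_A^* E(Div φ)` on ALL
  arrows of `C_{K₁/F₁}^rlf` and (ii)'s slim-rigidity clause, hypothesis-free (Thm. 4.9's `Ψ^Φ` over `Ψ^rlf` with its Div
  clause, descended along the base square: seat abc-iut-L1-d6's `DivisorMonoidIsoOver.exists_overBase`);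
* **`arith_rlf_exists_transportData`** — `Ψ^Base` (an equivalence, `1`-commuting with `Ψ^rlf`), `E`, `η`, the Div
  formula and `E_X(ℝ · Φ₁^birat(X)) = ℝ · Φ₂^birat(Ψ^Base X)` (part A's `arith_rlf_realSpanCompat`): exactly the binders
  of seat abc-iut-w4-d086's `ArithFrd.exists_picMap_thm64ii_functor` (`ArithmeticFrobenioidThm64iiFunctorForm.lean`) —
  composed in `ArithmeticFrobenioidThm64iiArith.lean` to Thm. 6.4 (ii) at THE data with no binder left.
No definitions; nothing of the paper is restated or strengthened; nothing here bears on [IUTchIII] Cor. 3.12.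
-/

noncomputable section

namespace Literature.AlgebraicGeometry.Frobenioids

open CategoryTheory Opposite Literature.AnabelianGeometry.EtaleTheta
open PreFrobenioid
open PreFrobenioidData (ofFunctor)

universe w v v' u u'

/-! ### Cor. 4.11 (ii)/(iii)/(iv) at THE realifications of the arithmetic Frobenioids -/


section Arith

variable (F₁ : Type) [Field F₁] [NumberField F₁] (K₁ : Type) [Field K₁] [Algebra F₁ K₁] [IsGalois F₁ K₁]
variable (F₂ : Type) [Field F₂] [NumberField F₂] (K₂ : Type) [Field K₂] [Algebra F₂ K₂] [IsGalois F₂ K₂]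
variable (hΦ₁ : IsPerfFactorialOn (arithDivisorFunctor F₁ K₁)) (hΦ₂ : IsPerfFactorialOn (arithDivisorFunctor F₂ K₂))

/-- **[FrdI] Cor. 4.11 (iii) AT THE REALIFICATIONS, as typed** (`PreFrobenioidData.Cor411iii` at THE realified
operations of `C_{K_i/F_i}^rlf → F_{Φ_i^rlf}` and THE Def. 4.5 (iii) parameters `rsParams`, support `PrimarySupp`),
for every equivalence `Ψ^rlf` — seat abc-iut-L1-t14's general closer over FSM-type bases applied to the Frobenioids
`C_{K_i/F_i}^rlf` (`arith_rlf_isFrobenioid`; `Φ^rlf` perf-factorial; `C₁^rlf` rational at THE birationalization).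
[cite: MochizukiFrdI2008, Cor. 4.11 (iii) p.92] -/
theorem arith_rlf_cor411iii
    (Ψ : rlf (ModelFrobenioid.toElem (arithDivisorFunctor F₁ K₁) (unitsFunctor F₁ K₁) (divNatTrans F₁ K₁))
          hΦ₁ ≌
        rlf (ModelFrobenioid.toElem (arithDivisorFunctor F₂ K₂) (unitsFunctor F₂ K₂) (divNatTrans F₂ K₂))
          hΦ₂) :
    (FrdI.Cor54Sub.rlfData
        (ModelFrobenioid.toElem (arithDivisorFunctor F₁ K₁) (unitsFunctor F₁ K₁) (divNatTrans F₁ K₁))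
        hΦ₁).Cor411iii
      (FrdI.Cor54Sub.rlfData
        (ModelFrobenioid.toElem (arithDivisorFunctor F₂ K₂) (unitsFunctor F₂ K₂) (divNatTrans F₂ K₂))
        hΦ₂) Ψ
      (rsParams (arith_rlf_isFrobenioid F₁ K₁) fun a 𝔭 => PrimarySupp a 𝔭)
      (rsParams (arith_rlf_isFrobenioid F₂ K₂) fun a 𝔭 => PrimarySupp a 𝔭) :=
  FrdI.cor411iii_of_cor411ii_of_isOfFSMType (arith_rlf_isFrobenioid F₁ K₁) (arith_rlf_isFrobenioid F₂ K₂)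
    (FinSubextCat.isOfFSMType F₁ K₁) (FinSubextCat.isOfFSMType F₂ K₂)
    (isPerfFactorialOn_rlfFunctor _) (isPerfFactorialOn_rlfFunctor _)
    (arith_rlf_isOfRationallyStandardType F₁ K₁).rational Ψ _ _
    (PreFrobenioid.cor411ii_ofFunctor_of_isOfFSMType (arith_rlf_isFrobenioid F₁ K₁) (arith_rlf_isFrobenioid F₂ K₂) Ψ
      (isPerfFactorialOn_rlfFunctor _) (isPerfFactorialOn_rlfFunctor _)
      (FinSubextCat.isOfFSMType F₁ K₁) (FinSubextCat.isOfFSMType F₂ K₂))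

/-- **[FrdI] Cor. 4.11 (iii) at the realifications — the CONCLUSION, hypothesis-free.** For every equivalence
`Ψ^rlf : C_{K₁/F₁}^rlf ⥲ C_{K₂/F₂}^rlf` there are a functor `Ψ^Base : D₁ ⥤ D₂`, an equivalence `1`-commuting with
`Ψ^rlf` over the projections `C_{K_i/F_i}^rlf → D_i` and `1`-unique with this property, and an isomorphism of
functors `Ψ^Φ : Φ₁^rlf ⥲ Φ₂^rlf` on `D₁` lying over `Ψ^Base` (natural w.r.t. pull-backs) — "the isomorphism of
monoids `Φ₁^rlf(A₁) ⥲ Φ₂^rlf(A₂)` [cf. Corollary 4.11, (iii)]" of the proof of Thm. 6.4 (ii), p. 115.  All antecedents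
(`Cor411Setting`, rationally standard type of both realifications at THE parameters — seat abc-iut-w5-d250's
`arith_rlf_isOfRationallyStandardType`) are theorems.
[cite: MochizukiFrdI2008, Cor. 4.11 (iii) p.92] [cite: MochizukiFrdI2008, Thm. 6.4 (ii) p.115] -/
theorem arith_rlf_cor411iii_conclusion
    (Ψ : rlf (ModelFrobenioid.toElem (arithDivisorFunctor F₁ K₁) (unitsFunctor F₁ K₁) (divNatTrans F₁ K₁))
          hΦ₁ ≌
        rlf (ModelFrobenioid.toElem (arithDivisorFunctor F₂ K₂) (unitsFunctor F₂ K₂) (divNatTrans F₂ K₂))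
          hΦ₂) :
    ∃ ΨBase : FinSubextCat F₁ K₁ ⥤ FinSubextCat F₂ K₂,
      PreFrobenioidData.OneUniqueSquare Ψ.functor
          (FrdI.Cor54Sub.rlfData
            (ModelFrobenioid.toElem (arithDivisorFunctor F₁ K₁) (unitsFunctor F₁ K₁) (divNatTrans F₁ K₁))
            hΦ₁).base
          (FrdI.Cor54Sub.rlfData
            (ModelFrobenioid.toElem (arithDivisorFunctor F₂ K₂) (unitsFunctor F₂ K₂) (divNatTrans F₂ K₂))
            hΦ₂).base ΨBase ∧
        Nonempty (PreFrobenioidData.DivisorMonoidIsoOverBase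
          (FrdI.Cor54Sub.rlfData
            (ModelFrobenioid.toElem (arithDivisorFunctor F₁ K₁) (unitsFunctor F₁ K₁) (divNatTrans F₁ K₁))
            hΦ₁)
          (FrdI.Cor54Sub.rlfData
            (ModelFrobenioid.toElem (arithDivisorFunctor F₂ K₂) (unitsFunctor F₂ K₂) (divNatTrans F₂ K₂))
            hΦ₂) ΨBase) :=
  arith_rlf_cor411iii F₁ K₁ F₂ K₂ hΦ₁ hΦ₂ Ψ (arith_rlf_cor411Setting F₁ K₁ F₂ K₂ hΦ₁ hΦ₂ Ψ)
    (arith_rlf_isOfRationallyStandardType F₁ K₁) (arith_rlf_isOfRationallyStandardType F₂ K₂)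

/-- **[FrdI] Cor. 4.11 (iv) AT THE REALIFICATIONS, as typed** (`PreFrobenioidData.Cor411iv` at THE realified
operations and THE parameters), for every equivalence `Ψ^rlf` (seat abc-iut-L1-t14's
`FrdI.cor411iv_of_cor411ii_of_isOfFSMType` — `C^rlf` is not of group-like type — over seat abc-iut-L1-d6's (ii), at the
Frobenioids `C_{K_i/F_i}^rlf`).
[cite: MochizukiFrdI2008, Cor. 4.11 (iv) p.92] -/
theorem arith_rlf_cor411iv
    (Ψ : rlf (ModelFrobenioid.toElem (arithDivisorFunctor F₁ K₁) (unitsFunctor F₁ K₁) (divNatTrans F₁ K₁))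
          hΦ₁ ≌
        rlf (ModelFrobenioid.toElem (arithDivisorFunctor F₂ K₂) (unitsFunctor F₂ K₂) (divNatTrans F₂ K₂))
          hΦ₂) :
    (FrdI.Cor54Sub.rlfData
        (ModelFrobenioid.toElem (arithDivisorFunctor F₁ K₁) (unitsFunctor F₁ K₁) (divNatTrans F₁ K₁))
        hΦ₁).Cor411iv
      (FrdI.Cor54Sub.rlfData
        (ModelFrobenioid.toElem (arithDivisorFunctor F₂ K₂) (unitsFunctor F₂ K₂) (divNatTrans F₂ K₂))
        hΦ₂) Ψ
      (rsParams (arith_rlf_isFrobenioid F₁ K₁) fun a 𝔭 => PrimarySupp a 𝔭)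
      (rsParams (arith_rlf_isFrobenioid F₂ K₂) fun a 𝔭 => PrimarySupp a 𝔭) :=
  FrdI.cor411iv_of_cor411ii_of_isOfFSMType (arith_rlf_isFrobenioid F₁ K₁) (arith_rlf_isFrobenioid F₂ K₂)
    (FinSubextCat.isOfFSMType F₁ K₁) (FinSubextCat.isOfFSMType F₂ K₂)
    (isPerfFactorialOn_rlfFunctor _) (isPerfFactorialOn_rlfFunctor _) (arith_rlf_not_isOfGroupLikeType F₁ K₁)
    (arith_rlf_isOfRationallyStandardType F₁ K₁).rational Ψ _ _
    (PreFrobenioid.cor411ii_ofFunctor_of_isOfFSMType (arith_rlf_isFrobenioid F₁ K₁) (arith_rlf_isFrobenioid F₂ K₂) Ψ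
      (isPerfFactorialOn_rlfFunctor _) (isPerfFactorialOn_rlfFunctor _)
      (FinSubextCat.isOfFSMType F₁ K₁) (FinSubextCat.isOfFSMType F₂ K₂))

/-- **[FrdI] Cor. 4.11 (iii)/(iv) at the realifications — THE data, hypothesis-free.** For every equivalence
`Ψ^rlf : C_{K₁/F₁}^rlf ⥲ C_{K₂/F₂}^rlf`: `Ψ^Base` (the `1`-unique base square of Cor. 4.11 (ii), with its rigidity clause
for slim `D_i`), `η : Base₂ ∘ Ψ^rlf ≅ Ψ^Base ∘ Base₁`, and `Ψ^Φ = E : Φ₁^rlf ⥲ Φ₂^rlf` on `D₁` over `Ψ^Base` with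
`Div(Ψ^rlf φ) = η_A^* E(Div φ)` for EVERY arrow `φ` of `C_{K₁/F₁}^rlf` — Thm. 4.9's `Ψ^Φ` over `Ψ^rlf` WITH its Div clause
(seat abc-iut-L1-t14's `T49.exists_divisorMonoidIsoOver_div_of_isOfFSMType`; `C^rlf` not group-like) descended along
the base square (seat abc-iut-L1-d6's `DivisorMonoidIsoOver.exists_overBase`, Def. 1.3 (i)(a)(b)(c) inputs of a Frobenioid).
[cite: MochizukiFrdI2008, Cor. 4.11 (iv) p.92] [cite: MochizukiFrdI2008, Thm. 4.9 p.88] -/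
theorem arith_rlf_exists_divTransportData
    (Ψ : rlf (ModelFrobenioid.toElem (arithDivisorFunctor F₁ K₁) (unitsFunctor F₁ K₁) (divNatTrans F₁ K₁))
          hΦ₁ ≌
        rlf (ModelFrobenioid.toElem (arithDivisorFunctor F₂ K₂) (unitsFunctor F₂ K₂) (divNatTrans F₂ K₂))
          hΦ₂) :
    ∃ (ΨBase : FinSubextCat F₁ K₁ ⥤ FinSubextCat F₂ K₂)
      (E : PreFrobenioidData.DivisorMonoidIsoOverBase
        (FrdI.Cor54Sub.rlfData
          (ModelFrobenioid.toElem (arithDivisorFunctor F₁ K₁) (unitsFunctor F₁ K₁) (divNatTrans F₁ K₁))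
          hΦ₁)
        (FrdI.Cor54Sub.rlfData
          (ModelFrobenioid.toElem (arithDivisorFunctor F₂ K₂) (unitsFunctor F₂ K₂) (divNatTrans F₂ K₂))
          hΦ₂) ΨBase)
      (η : Ψ.functor ⋙
          (FrdI.Cor54Sub.rlfData
            (ModelFrobenioid.toElem (arithDivisorFunctor F₂ K₂) (unitsFunctor F₂ K₂) (divNatTrans F₂ K₂))
            hΦ₂).base ≅
        (FrdI.Cor54Sub.rlfData
            (ModelFrobenioid.toElem (arithDivisorFunctor F₁ K₁) (unitsFunctor F₁ K₁) (divNatTrans F₁ K₁))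
            hΦ₁).base ⋙ ΨBase),
      PreFrobenioidData.OneUniqueSquare Ψ.functor
          (FrdI.Cor54Sub.rlfData
            (ModelFrobenioid.toElem (arithDivisorFunctor F₁ K₁) (unitsFunctor F₁ K₁) (divNatTrans F₁ K₁))
            hΦ₁).base
          (FrdI.Cor54Sub.rlfData
            (ModelFrobenioid.toElem (arithDivisorFunctor F₂ K₂) (unitsFunctor F₂ K₂) (divNatTrans F₂ K₂))
            hΦ₂).base ΨBase ∧
      (IsSlim (FinSubextCat F₁ K₁) → IsSlim (FinSubextCat F₂ K₂) →
        IsRigidFunctor (Ψ.functor ⋙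
          (FrdI.Cor54Sub.rlfData
            (ModelFrobenioid.toElem (arithDivisorFunctor F₂ K₂) (unitsFunctor F₂ K₂) (divNatTrans F₂ K₂))
            hΦ₂).base) ∧
        IsRigidFunctor
          ((FrdI.Cor54Sub.rlfData
            (ModelFrobenioid.toElem (arithDivisorFunctor F₁ K₁) (unitsFunctor F₁ K₁) (divNatTrans F₁ K₁))
            hΦ₁).base ⋙ ΨBase)) ∧
      (∀ ⦃A B : rlf (ModelFrobenioid.toElem (arithDivisorFunctor F₁ K₁) (unitsFunctor F₁ K₁) (divNatTrans F₁ K₁))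
          hΦ₁⦄ (φ : A ⟶ B),
        Div (rlfToElem (ModelFrobenioid.toElem (arithDivisorFunctor F₂ K₂) (unitsFunctor F₂ K₂) (divNatTrans F₂ K₂))
            hΦ₂) (Ψ.functor.map φ) =
          pull _ (η.hom.app A)
            (E.iso (baseObj (rlfToElem (ModelFrobenioid.toElem (arithDivisorFunctor F₁ K₁) (unitsFunctor F₁ K₁)
              (divNatTrans F₁ K₁)) hΦ₁) A)
              (Div (rlfToElem (ModelFrobenioid.toElem (arithDivisorFunctor F₁ K₁) (unitsFunctor F₁ K₁)
                (divNatTrans F₁ K₁)) hΦ₁) φ))) := by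
  have hR₁ := arith_rlf_isFrobenioid F₁ K₁
  have hR₂ := arith_rlf_isFrobenioid F₂ K₂
  have hs := arith_rlf_cor411Setting F₁ K₁ F₂ K₂ hΦ₁ hΦ₂ Ψ
  obtain ⟨ΨBase, hsq, hrig⟩ := PreFrobenioid.cor411ii_ofFunctor_of_isOfFSMType hR₁ hR₂ Ψ
    (isPerfFactorialOn_rlfFunctor _) (isPerfFactorialOn_rlfFunctor _)
    (FinSubextCat.isOfFSMType F₁ K₁) (FinSubextCat.isOfFSMType F₂ K₂) hs
  obtain ⟨η⟩ := hsq.2.1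
  obtain ⟨E, hdiv⟩ := FrdI.T49.exists_divisorMonoidIsoOver_div_of_isOfFSMType hR₁ hR₂
    (FinSubextCat.isOfFSMType F₁ K₁) (FinSubextCat.isOfFSMType F₂ K₂)
    (isPerfFactorialOn_rlfFunctor _) (isPerfFactorialOn_rlfFunctor _) hs.standard.1 hs.standard.2
    (arith_rlf_not_isOfGroupLikeType F₁ K₁) (arith_rlf_isOfRationallyStandardType F₁ K₁).rational Ψ
  obtain ⟨E', hE'⟩ := E.exists_overBase ΨBase η (exists_base_iso_of_isFrobenioid _ hR₁)
    (exists_preSteps_of_base_iso _ hR₁) (fun A _ f => exists_arrow_over_base _ hR₁ A f)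
  refine ⟨ΨBase, E', η, hsq, hrig, fun A B φ => ?_⟩
  have hgoal :
      (FrdI.Cor54Sub.rlfData (ModelFrobenioid.toElem (arithDivisorFunctor F₂ K₂) (unitsFunctor F₂ K₂)
          (divNatTrans F₂ K₂)) hΦ₂).div (Ψ.functor.map φ) =
        (FrdI.Cor54Sub.rlfData (ModelFrobenioid.toElem (arithDivisorFunctor F₂ K₂) (unitsFunctor F₂ K₂)
          (divNatTrans F₂ K₂)) hΦ₂).pull (η.hom.app A)
          (E'.iso ((FrdI.Cor54Sub.rlfData (ModelFrobenioid.toElem (arithDivisorFunctor F₁ K₁) (unitsFunctor F₁ K₁)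
            (divNatTrans F₁ K₁)) hΦ₁).base.obj A)
            ((FrdI.Cor54Sub.rlfData (ModelFrobenioid.toElem (arithDivisorFunctor F₁ K₁) (unitsFunctor F₁ K₁)
              (divNatTrans F₁ K₁)) hΦ₁).div φ)) := by
    rw [hE', ← PreFrobenioidData.pull_comp, Iso.hom_inv_id_app, PreFrobenioidData.pull_id]; exact (hdiv φ).symm
  exact hgoal
/-- **T64ii/E5 — THE transport data for `Pic`, hypothesis-free.**  For every equivalence
`Ψ^rlf : C_{K₁/F₁}^rlf ⥲ C_{K₂/F₂}^rlf` there are `Ψ^Base : D₁ ⥤ D₂` (an equivalence `1`-commuting with `Ψ^rlf` over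
the projections and `1`-unique: `OneUniqueSquare`), an isomorphism of functors `E = Ψ^Φ : Φ₁^rlf ⥲ Φ₂^rlf` on `D₁`
over `Ψ^Base` (components `E.iso X : Φ₁^rlf(X) ≃* Φ₂^rlf(Ψ^Base X)`, natural w.r.t. pull-backs: `E.natural`) and
`η : Base₂ ∘ Ψ^rlf ≅ Ψ^Base ∘ Base₁` such that `Div(Ψ^rlf φ) = η_A^* E(Div φ)` for every arrow `φ`, and — Cor. 4.10 — **`E_X` carries the rational function monoid `ℝ · Φ₁^birat(X)` of `C_{K₁/F₁}^rlf`
ONTO `ℝ · Φ₂^birat(Ψ^Base X)`** (THE real spans of Prop. 5.3, seat abc-iut-L1-d2's `RealificationData.realSpan` of the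
CANONICAL data): exactly the inputs `(ΨBase, e, hnat, hspan)` of seat abc-iut-w4-d086's `Pic` transport
`GpSubfunctor.exists_pic_mulEquiv_of_monoidIso` (T64ii/E1) — "the isomorphism `Pic_Φ(A₁) ⥲ Pic_Φ(A₂)` … arises
from an isomorphism of monoids `Φ₁^rlf(A₁) ⥲ Φ₂^rlf(A₂)` [cf. Corollary 4.11, (iii)]" (p. 115 l. 34 – p. 116 l. 2).
[cite: MochizukiFrdI2008, Thm. 6.4 (ii) p.115] [cite: MochizukiFrdI2008, Cor. 4.10 p.90] -/
theorem arith_rlf_exists_transportData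
    (Ψ : rlf (ModelFrobenioid.toElem (arithDivisorFunctor F₁ K₁) (unitsFunctor F₁ K₁) (divNatTrans F₁ K₁))
          hΦ₁ ≌
        rlf (ModelFrobenioid.toElem (arithDivisorFunctor F₂ K₂) (unitsFunctor F₂ K₂) (divNatTrans F₂ K₂))
          hΦ₂) :
    ∃ (ΨBase : FinSubextCat F₁ K₁ ⥤ FinSubextCat F₂ K₂)
      (E : PreFrobenioidData.DivisorMonoidIsoOverBase
        (FrdI.Cor54Sub.rlfData
          (ModelFrobenioid.toElem (arithDivisorFunctor F₁ K₁) (unitsFunctor F₁ K₁) (divNatTrans F₁ K₁))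
          hΦ₁)
        (FrdI.Cor54Sub.rlfData
          (ModelFrobenioid.toElem (arithDivisorFunctor F₂ K₂) (unitsFunctor F₂ K₂) (divNatTrans F₂ K₂))
          hΦ₂) ΨBase)
      (η : Ψ.functor ⋙
          (FrdI.Cor54Sub.rlfData
            (ModelFrobenioid.toElem (arithDivisorFunctor F₂ K₂) (unitsFunctor F₂ K₂) (divNatTrans F₂ K₂))
            hΦ₂).base ≅
        (FrdI.Cor54Sub.rlfData
            (ModelFrobenioid.toElem (arithDivisorFunctor F₁ K₁) (unitsFunctor F₁ K₁) (divNatTrans F₁ K₁))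
            hΦ₁).base ⋙ ΨBase),
      PreFrobenioidData.OneUniqueSquare Ψ.functor
          (FrdI.Cor54Sub.rlfData
            (ModelFrobenioid.toElem (arithDivisorFunctor F₁ K₁) (unitsFunctor F₁ K₁) (divNatTrans F₁ K₁))
            hΦ₁).base
          (FrdI.Cor54Sub.rlfData
            (ModelFrobenioid.toElem (arithDivisorFunctor F₂ K₂) (unitsFunctor F₂ K₂) (divNatTrans F₂ K₂))
            hΦ₂).base ΨBase ∧
      (∀ ⦃A B : rlf (ModelFrobenioid.toElem (arithDivisorFunctor F₁ K₁) (unitsFunctor F₁ K₁) (divNatTrans F₁ K₁))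
          hΦ₁⦄ (φ : A ⟶ B),
        Div (rlfToElem (ModelFrobenioid.toElem (arithDivisorFunctor F₂ K₂) (unitsFunctor F₂ K₂) (divNatTrans F₂ K₂))
            hΦ₂) (Ψ.functor.map φ) =
          pull _ (η.hom.app A)
            (E.iso (baseObj (rlfToElem (ModelFrobenioid.toElem (arithDivisorFunctor F₁ K₁) (unitsFunctor F₁ K₁)
              (divNatTrans F₁ K₁)) hΦ₁) A)
              (Div (rlfToElem (ModelFrobenioid.toElem (arithDivisorFunctor F₁ K₁) (unitsFunctor F₁ K₁)
                (divNatTrans F₁ K₁)) hΦ₁) φ))) ∧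
      (∀ X : FinSubextCat F₁ K₁,
        (((RealificationData.canonical (arithDivisorFunctor F₁ K₁)
              (IsPerfFactorialOn.op hΦ₁)).realSpan
            (biratSubfunctor (ModelFrobenioid.toElem (arithDivisorFunctor F₁ K₁) (unitsFunctor F₁ K₁)
              (divNatTrans F₁ K₁)))).carrier X).map (MonGp.map (E.iso X).toMonoidHom) =
          ((RealificationData.canonical (arithDivisorFunctor F₂ K₂)
              (IsPerfFactorialOn.op hΦ₂)).realSpan
            (biratSubfunctor (ModelFrobenioid.toElem (arithDivisorFunctor F₂ K₂) (unitsFunctor F₂ K₂)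
              (divNatTrans F₂ K₂)))).carrier (ΨBase.obj X)) := by
  obtain ⟨ΨBase, E, η, hsq, -, hdiv⟩ := arith_rlf_exists_divTransportData F₁ K₁ F₂ K₂ hΦ₁ hΦ₂ Ψ
  haveI : ΨBase.IsEquivalence := hsq.1
  exact ⟨ΨBase, E, η, hsq, hdiv, arith_rlf_realSpanCompat F₁ K₁ F₂ K₂ hΦ₁ hΦ₂ Ψ ΨBase E η hdiv⟩

end Arith

end Literature.AlgebraicGeometry.Frobenioids

end
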